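import Literature.Computability.Complexity.StackPrograms
import HarnessLib

/-!
# Metering a stack register program by a fuel register (the step counter of clocked simulations)

Toolkit for the tree's stack register machines (`StackMachines.lean`: `SProg K`, binary stack
registers `Fin K`, instructions `push k b | pop k jt jf jn | goto j`, total one-step semantics
`SProg.step`, a program counter at or beyond the end meaning *halted*) and their structured
front end (`StackPrograms.lean`: `Com`, exact-cost big-step semantics `Com.Exec`, compiler
`Com.code` / `Com.compile` with adequacy `Com.Exec.compile_iterate`).

A *clocked* run of a program — "execute at most `m` instructions, then give up" — is the time
counter of every universal simulation (Arora–Barak 2009, §1.4.1 "Universal TM with time bound":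
"the time counter is used to keep track of the number of steps that the computation has taken so
far"; Žák 1983 / Arora–Barak 2009, proof of Thm. 3.2: the diagonalizing machine simulates "for
`g(n)` steps" and then stops). On stack register programs the counter is realised WITHOUT any
interpreter, by a program transformation: the **metered copy** `SProg.meter φ b' tout P` of a
program `P` (to be placed at address `b'` of a larger program) precedes every instruction of `P`
by `pop φ · · tout` on a fresh *fuel register* `φ`; the instruction at address `i` of `P` sits at
`b' + 2 i + 1`, jump targets `j` become `b' + 2 j`, and an empty fuel register diverts control to
the *time-out address* `tout`.

Main results (`P` does not mention `φ`, `SProg.FreeOf`):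

* `SProg.iterate_meter` — **simulation while the fuel lasts**: `t` steps of `P` taken inside the
  program, from `⟨pc, R⟩`, are matched by exactly `2 t` steps of any program containing the
  metered copy at `b'`, from `⟨b' + 2 pc, R[φ := cs ++ u]⟩` with `|cs| = t`, arriving at
  `⟨b' + 2 pc', R'[φ := u]⟩`;
* `SProg.iterate_meter_timeout` — **time-out**: with exactly `t` fuel symbols and `t + 1` steps
  of `P` still inside the program, `2 t + 1` steps arrive at `⟨tout, R'[φ := []]⟩`;
* `SProg.iterate_meter_exit` — **exit**: if `P` leaves its code (program counter `= |P|`) for the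
  first time after `T` steps, then with fuel `cs ++ u`, `|cs| = T`, the metered copy arrives after
  `2 T` steps at its own end `b' + 2 |P|` with the registers of `P` and the fuel `u` left over —
  so the LEFTOVER FUEL tells a completed run (`u ≠ []` whenever `|fuel| > T`) from a time-out;
* `SProg.pc_iterate_le` — programs whose jump targets are at most `|P|` (`SProg.TargetsLe`) leave
  their code only through the address `|P|`; `SProg.exists_exitTime` — the first exit time;
* `SProg.regsTotal_step_le` — one step lengthens the registers by at most one bit in total (the
  size of the registers after a time-out is at most the initial size plus the fuel spent);
* for compiled structured programs: `Com.targetsLe_of_mem_code` (all jump targets of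
  `Com.code c base fin` are at most `max (base + |c|) fin`), `Com.freeOf_code` (the code mentions
  only the registers of `c`), `Com.compile_targetsLe`, and `Com.Exec.exists_exitTime` — a normal
  execution `Exec c R false R' t` gives a first exit time `T ≤ t` of `compile c` from `⟨0, R⟩`,
  all earlier program counters `< |c|`, arriving at `⟨|c|, R'⟩`.

With these, a structured program can be run under a step budget INSIDE a larger stack register
program, the two outcomes (completed with its specified registers / timed out with unspecified
registers of bounded size) being told apart by the leftover fuel; this is the clock of the
diagonalizing machine of the nondeterministic time hierarchy theorem (sequel files).

Nothing here is in Mathlib (no stack register machines there); the tree's clocked combinators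
(`TM2Iterate.lean`, `IterateFP.lean`, `OracleIdleClock.lean`) iterate a whole polynomial-time
FUNCTION a given number of times, whereas the meter counts single INSTRUCTIONS of an arbitrary,
possibly diverging, program — the form needed for linear-time clocking.

## References

* S. Arora, B. Barak, *Computational Complexity: A Modern Approach*, CUP 2009, §1.4.1 (universal
  TM with time bound), Thm. 3.2 (proof: clocked simulation in the nondeterministic hierarchy)
  [AroraBarakCC2009].
* S. Žák, *A Turing machine time hierarchy*, Theoret. Comput. Sci. 26 (1983) 327–333 [Zak1983].
* T. Nipkow, G. Klein, *Concrete Semantics with Isabelle/HOL*, Springer 2014, §8.3 (reasoning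
  about placed machine code).
-/

namespace Literature.Computability.Complexity

open Function

/-! ### Instructions: mentioned registers, jump targets, the metered pair -/

namespace SInstr

variable {K : ℕ}

/-- The instruction does not mention the register `φ`. [folklore] -/
def FreeOf (φ : Fin K) : SInstr K → Prop
  | push k _ => k ≠ φ
  | pop k _ _ _ => k ≠ φ
  | goto _ => True

/-- Every jump target of the instruction is at most `n`. [folklore] -/
def TargetsLe (n : ℕ) : SInstr K → Prop
  | push _ _ => True
  | pop _ jt jf jn => jt ≤ n ∧ jf ≤ n ∧ jn ≤ n
  | goto j => j ≤ n

/-- `TargetsLe` is monotone in the bound. [folklore] -/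
theorem TargetsLe.mono {n n' : ℕ} (h : n ≤ n') : ∀ {ins : SInstr K}, ins.TargetsLe n → ins.TargetsLe n'
  | push _ _, _ => trivial
  | pop _ _ _ _, ⟨h₁, h₂, h₃⟩ => ⟨h₁.trans h, h₂.trans h, h₃.trans h⟩
  | goto _, hj => le_trans hj h

/-- **The metered pair** of the instruction at address `i`: first `pop φ` (both bit branches
continue with the instruction proper at `b' + 2 i + 1`, an empty fuel register jumps to `tout`),
then the instruction with its jump targets `j` relocated to `b' + 2 j`. (Arora–Barak 2009,
§1.4.1: decrement the time counter before each simulated step.) [cite: AroraBarakCC2009, §1.4.1] -/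
def meter (φ : Fin K) (b' tout i : ℕ) : SInstr K → List (SInstr K)
  | push k c => [pop φ (b' + 2 * i + 1) (b' + 2 * i + 1) tout, push k c]
  | pop k jt jf jn =>
      [pop φ (b' + 2 * i + 1) (b' + 2 * i + 1) tout, pop k (b' + 2 * jt) (b' + 2 * jf) (b' + 2 * jn)]
  | goto j => [pop φ (b' + 2 * i + 1) (b' + 2 * i + 1) tout, goto (b' + 2 * j)]

/-- A metered pair has two instructions. [folklore] -/
@[simp] theorem length_meter (φ : Fin K) (b' tout i : ℕ) (ins : SInstr K) :
    (ins.meter φ b' tout i).length = 2 := by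
  cases ins <;> rfl

/-- The first instruction of the metered pair: the fuel test. [folklore] -/
theorem meter_getElem_zero (φ : Fin K) (b' tout i : ℕ) (ins : SInstr K) :
    (ins.meter φ b' tout i)[0]? = some (pop φ (b' + 2 * i + 1) (b' + 2 * i + 1) tout) := by
  cases ins <;> rfl

/-- The relocated instruction proper. [folklore] -/
def reloc (b' : ℕ) : SInstr K → SInstr K
  | push k c => push k c
  | pop k jt jf jn => pop k (b' + 2 * jt) (b' + 2 * jf) (b' + 2 * jn)
  | goto j => goto (b' + 2 * j)

/-- The second instruction of the metered pair: the relocated instruction. [folklore] -/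
theorem meter_getElem_one (φ : Fin K) (b' tout i : ℕ) (ins : SInstr K) :
    (ins.meter φ b' tout i)[1]? = some (ins.reloc b') := by
  cases ins <;> rfl

end SInstr

/-! ### Programs: the metered copy and its placement -/

namespace SProg

variable {K : ℕ}

/-- The program does not mention the register `φ`. [folklore] -/
def FreeOf (φ : Fin K) (P : SProg K) : Prop := ∀ ins ∈ P, ins.FreeOf φ

/-- Every jump target of the program is at most `n`. [folklore] -/
def TargetsLe (n : ℕ) (P : SProg K) : Prop := ∀ ins ∈ P, ins.TargetsLe n

/-- Metering from address `i` on (auxiliary to `meter`). [folklore] -/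
def meterFrom (φ : Fin K) (b' tout : ℕ) : ℕ → SProg K → SProg K
  | _, [] => []
  | i, ins :: P => ins.meter φ b' tout i ++ meterFrom φ b' tout (i + 1) P

/-- **The metered copy** of `P` for placement at `b'` with time-out address `tout`: instruction
`i` of `P` becomes the pair `SInstr.meter φ b' tout i` at addresses `b' + 2 i`, `b' + 2 i + 1`.
[cite: AroraBarakCC2009, §1.4.1] -/
def meter (φ : Fin K) (b' tout : ℕ) (P : SProg K) : SProg K := meterFrom φ b' tout 0 P

/-- Length of `meterFrom`. [folklore] -/
@[simp] theorem length_meterFrom (φ : Fin K) (b' tout : ℕ) :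
    ∀ (i : ℕ) (P : SProg K), (meterFrom φ b' tout i P).length = 2 * P.length
  | _, [] => rfl
  | i, ins :: P => by
    rw [meterFrom, List.length_append, SInstr.length_meter, length_meterFrom φ b' tout (i + 1) P,
      List.length_cons]
    ring

/-- The metered copy is twice as long. [folklore] -/
@[simp] theorem length_meter (φ : Fin K) (b' tout : ℕ) (P : SProg K) :
    (P.meter φ b' tout).length = 2 * P.length :=
  length_meterFrom φ b' tout 0 P

/-- Indexing `meterFrom`: the even positions hold the fuel tests. [folklore] -/
theorem getElem?_meterFrom_even (φ : Fin K) (b' tout : ℕ) :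
    ∀ (i : ℕ) (P : SProg K) (j : ℕ) (ins : SInstr K), P[j]? = some ins →
      (meterFrom φ b' tout i P)[2 * j]? =
        some (SInstr.pop φ (b' + 2 * (i + j) + 1) (b' + 2 * (i + j) + 1) tout)
  | _, [], j, ins, h => by simp at h
  | i, ins₀ :: P, 0, ins, h => by
    rw [meterFrom, Nat.mul_zero, List.getElem?_append_left (by simp), Nat.add_zero]
    exact SInstr.meter_getElem_zero φ b' tout i ins₀
  | i, ins₀ :: P, j + 1, ins, h => by
    rw [List.getElem?_cons_succ] at h
    rw [meterFrom, show 2 * (j + 1) = (ins₀.meter φ b' tout i).length + 2 * j by simp; ring,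
      List.getElem?_append_right (Nat.le_add_right _ _), Nat.add_sub_cancel_left,
      getElem?_meterFrom_even φ b' tout (i + 1) P j ins h, show i + 1 + j = i + (j + 1) by ring]

/-- Indexing `meterFrom`: the odd positions hold the relocated instructions. [folklore] -/
theorem getElem?_meterFrom_odd (φ : Fin K) (b' tout : ℕ) :
    ∀ (i : ℕ) (P : SProg K) (j : ℕ) (ins : SInstr K), P[j]? = some ins →
      (meterFrom φ b' tout i P)[2 * j + 1]? = some (ins.reloc b')
  | _, [], j, ins, h => by simp at h
  | i, ins₀ :: P, 0, ins, h => by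
    have e : ins₀ = ins := by simpa using h
    rw [meterFrom, Nat.mul_zero, Nat.zero_add, List.getElem?_append_left (by simp), ← e]
    exact SInstr.meter_getElem_one φ b' tout i ins₀
  | i, ins₀ :: P, j + 1, ins, h => by
    rw [List.getElem?_cons_succ] at h
    rw [meterFrom, show 2 * (j + 1) + 1 = (ins₀.meter φ b' tout i).length + (2 * j + 1) by simp; ring,
      List.getElem?_append_right (Nat.le_add_right _ _), Nat.add_sub_cancel_left,
      getElem?_meterFrom_odd φ b' tout (i + 1) P j ins h]

/-- In a program containing the metered copy at `b'`, address `b' + 2 j` holds the fuel test of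
instruction `j`. [folklore] -/
theorem placed_meter_even {Q P : SProg K} {φ : Fin K} {b' tout : ℕ}
    (hQ : Com.Placed Q b' (P.meter φ b' tout)) {j : ℕ} {ins : SInstr K} (h : P[j]? = some ins) :
    Q[b' + 2 * j]? = some (SInstr.pop φ (b' + 2 * j + 1) (b' + 2 * j + 1) tout) := by
  have hj : j < P.length := (List.getElem?_eq_some_iff.1 h).1
  have hlt : 2 * j < (P.meter φ b' tout).length := by rw [length_meter]; omega
  rw [hQ (2 * j) hlt, ← List.getElem?_eq_getElem hlt]
  have := getElem?_meterFrom_even φ b' tout 0 P j ins h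
  rw [Nat.zero_add] at this
  exact this

/-- In a program containing the metered copy at `b'`, address `b' + 2 j + 1` holds the relocated
instruction `j`. [folklore] -/
theorem placed_meter_odd {Q P : SProg K} {φ : Fin K} {b' tout : ℕ}
    (hQ : Com.Placed Q b' (P.meter φ b' tout)) {j : ℕ} {ins : SInstr K} (h : P[j]? = some ins) :
    Q[b' + 2 * j + 1]? = some (ins.reloc b') := by
  have hj : j < P.length := (List.getElem?_eq_some_iff.1 h).1
  have hlt : 2 * j + 1 < (P.meter φ b' tout).length := by rw [length_meter]; omega
  rw [Nat.add_assoc, hQ (2 * j + 1) hlt, ← List.getElem?_eq_getElem hlt]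
  exact getElem?_meterFrom_odd φ b' tout 0 P j ins h

/-! ### Register files with a reserved fuel register -/

/-- **A program that does not mention `φ` commutes with rewriting `φ`**: one step from
`⟨pc, R[φ := v]⟩` is the step from `⟨pc, R⟩` with `φ` rewritten afterwards. [folklore] -/
theorem step_update_of_freeOf {P : SProg K} {φ : Fin K} (hP : P.FreeOf φ) (pc : ℕ)
    (R : Regs (Fin K)) (v : List Bool) :
    P.step ⟨pc, update R φ v⟩ = ⟨(P.step ⟨pc, R⟩).pc, update (P.step ⟨pc, R⟩).regs φ v⟩ := by
  unfold SProg.step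
  cases hins : P[pc]? with
  | none => rfl
  | some ins =>
    have hf := hP ins (List.mem_of_getElem? hins)
    cases ins with
    | push k c =>
      have hk : k ≠ φ := hf
      simp only [update_of_ne hk]
      rw [update_comm hk]
    | goto j => rfl
    | pop k jt jf jn =>
      have hk : k ≠ φ := hf
      simp only [update_of_ne hk]
      rcases hRk : R k with _ | ⟨_ | _, w⟩
      · rfl
      · simp only [update_comm hk]
      · simp only [update_comm hk]

/-- Iterated form of `step_update_of_freeOf`. [folklore] -/
theorem iterate_update_of_freeOf {P : SProg K} {φ : Fin K} (hP : P.FreeOf φ) (v : List Bool) :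
    ∀ (t : ℕ) (pc : ℕ) (R : Regs (Fin K)),
      P.step^[t] ⟨pc, update R φ v⟩ =
        ⟨(P.step^[t] ⟨pc, R⟩).pc, update (P.step^[t] ⟨pc, R⟩).regs φ v⟩
  | 0, _, _ => rfl
  | t + 1, pc, R => by
    rw [iterate_succ_apply, iterate_succ_apply, step_update_of_freeOf hP,
      iterate_update_of_freeOf hP v t]

/-- A program that does not mention `φ` leaves `φ` unchanged. [folklore] -/
theorem step_regs_of_freeOf {P : SProg K} {φ : Fin K} (hP : P.FreeOf φ) (c : SCfg K) :
    (P.step c).regs φ = c.regs φ := by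
  obtain ⟨pc, R⟩ := c
  have h := step_update_of_freeOf hP pc R (R φ)
  rw [update_eq_self] at h
  rw [h]
  simp

/-- Iterated form of `step_regs_of_freeOf`. [folklore] -/
theorem iterate_regs_of_freeOf {P : SProg K} {φ : Fin K} (hP : P.FreeOf φ) (c : SCfg K) :
    ∀ t : ℕ, (P.step^[t] c).regs φ = c.regs φ
  | 0 => rfl
  | t + 1 => by rw [iterate_succ_apply', step_regs_of_freeOf hP, iterate_regs_of_freeOf hP c t]

/-! ### Simulation -/

section Simulation

variable {Q P : SProg K} {φ : Fin K} {b' tout : ℕ}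

/-- **One metered step with fuel**: from `⟨b' + 2 pc, R[φ := c :: u]⟩`, two steps of the
ambient program execute the fuel test and the relocated instruction, arriving at
`⟨b' + 2 pc', R'[φ := u]⟩` for `⟨pc', R'⟩ = P.step ⟨pc, R⟩`. [cite: AroraBarakCC2009, §1.4.1] -/
theorem step_step_meter (hQ : Com.Placed Q b' (P.meter φ b' tout)) (hP : P.FreeOf φ)
    {pc : ℕ} (hpc : pc < P.length) (R : Regs (Fin K)) (c : Bool) (u : List Bool) :
    Q.step (Q.step ⟨b' + 2 * pc, update R φ (c :: u)⟩) =
      ⟨b' + 2 * (P.step ⟨pc, R⟩).pc, update (P.step ⟨pc, R⟩).regs φ u⟩ := by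
  obtain ⟨ins, hins⟩ : ∃ ins, P[pc]? = some ins := ⟨P[pc], List.getElem?_eq_getElem hpc⟩
  have hf := hP ins (List.mem_of_getElem? hins)
  -- the fuel test
  have h1 : Q.step ⟨b' + 2 * pc, update R φ (c :: u)⟩ = ⟨b' + 2 * pc + 1, update R φ u⟩ := by
    rw [Com.step_of_getElem? (placed_meter_even hQ hins)]
    simp only [update_self, update_idem]
    cases c <;> rfl
  rw [h1, Com.step_of_getElem? (placed_meter_odd hQ hins)]
  -- the relocated instruction
  have hstep : P.step ⟨pc, R⟩ = _ := Com.step_of_getElem? hins R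
  cases ins with
  | push k b =>
    have hk : k ≠ φ := hf
    rw [hstep]
    show (⟨b' + 2 * pc + 1 + 1, update (update R φ u) k (b :: update R φ u k)⟩ : SCfg K) =
      ⟨b' + 2 * (pc + 1), update (update R k (b :: R k)) φ u⟩
    rw [update_of_ne hk, update_comm hk, show b' + 2 * pc + 1 + 1 = b' + 2 * (pc + 1) by ring]
  | goto j =>
    rw [hstep]
    show (⟨b' + 2 * j, update R φ u⟩ : SCfg K) = ⟨b' + 2 * j, update R φ u⟩
    rfl
  | pop k jt jf jn =>
    have hk : k ≠ φ := hf
    rw [hstep]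
    simp only [SInstr.reloc, update_of_ne hk]
    rcases hRk : R k with _ | ⟨_ | _, w⟩
    · rfl
    · simp only [update_comm hk]
    · simp only [update_comm hk]

/-- **Simulation while the fuel lasts**: if the first `t` configurations of `P` from `⟨pc, R⟩`
are inside the program, then `2 t` metered steps with fuel `cs ++ u`, `|cs| = t`, arrive at the
metered image of `P.step^[t] ⟨pc, R⟩` with fuel `u`. [cite: AroraBarakCC2009, §1.4.1] -/
theorem iterate_meter (hQ : Com.Placed Q b' (P.meter φ b' tout)) (hP : P.FreeOf φ) :
    ∀ (t : ℕ) (pc : ℕ) (R : Regs (Fin K)) (cs u : List Bool), cs.length = t →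
      (∀ m < t, (P.step^[m] ⟨pc, R⟩).pc < P.length) →
      Q.step^[2 * t] ⟨b' + 2 * pc, update R φ (cs ++ u)⟩ =
        ⟨b' + 2 * (P.step^[t] ⟨pc, R⟩).pc, update (P.step^[t] ⟨pc, R⟩).regs φ u⟩
  | 0, pc, R, cs, u, hcs, _ => by
    rw [List.length_eq_zero_iff.1 hcs]
    rfl
  | t + 1, pc, R, cs, u, hcs, hact => by
    obtain ⟨c, cs, rfl⟩ : ∃ c cs', cs = c :: cs' := by
      cases cs with
      | nil => simp at hcs
      | cons c cs => exact ⟨c, cs, rfl⟩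
    simp only [List.length_cons, Nat.add_right_cancel_iff] at hcs
    have h0 : pc < P.length := by simpa using hact 0 (Nat.succ_pos t)
    rw [show 2 * (t + 1) = 2 * t + 2 by ring, iterate_add_apply, List.cons_append,
      show Q.step^[2] (⟨b' + 2 * pc, update R φ (c :: (cs ++ u))⟩ : SCfg K) =
        Q.step (Q.step ⟨b' + 2 * pc, update R φ (c :: (cs ++ u))⟩) from rfl,
      step_step_meter hQ hP h0, iterate_meter hQ hP t _ _ cs u hcs
        (fun m hm => by rw [← iterate_succ_apply]; exact hact (m + 1) (by omega)),
      ← iterate_succ_apply]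

/-- **Time-out**: if the first `t + 1` configurations of `P` from `⟨pc, R⟩` are inside the
program and there are exactly `t` fuel symbols, then `2 t + 1` metered steps arrive at the
time-out address with the registers of `P.step^[t] ⟨pc, R⟩` and an empty fuel register.
[cite: AroraBarakCC2009, §1.4.1] -/
theorem iterate_meter_timeout (hQ : Com.Placed Q b' (P.meter φ b' tout)) (hP : P.FreeOf φ)
    (t pc : ℕ) (R : Regs (Fin K)) (cs : List Bool) (hcs : cs.length = t)
    (hact : ∀ m ≤ t, (P.step^[m] ⟨pc, R⟩).pc < P.length) :
    Q.step^[2 * t + 1] ⟨b' + 2 * pc, update R φ cs⟩ =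
      ⟨tout, update (P.step^[t] ⟨pc, R⟩).regs φ []⟩ := by
  rw [show 2 * t + 1 = 1 + 2 * t by ring, iterate_add_apply, iterate_one,
    show cs = cs ++ [] by simp,
    iterate_meter hQ hP t pc R cs [] hcs fun m hm => hact m hm.le]
  set C := P.step^[t] ⟨pc, R⟩
  have hC : C.pc < P.length := hact t le_rfl
  obtain ⟨ins, hins⟩ : ∃ ins, P[C.pc]? = some ins := ⟨P[C.pc], List.getElem?_eq_getElem hC⟩
  rw [Com.step_of_getElem? (placed_meter_even hQ hins)]
  simp

/-- **Exit**: if `P` is inside its code for `T` steps from `⟨pc, R⟩` and then at the address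
`|P|`, the metered copy with fuel `cs ++ u`, `|cs| = T`, arrives after `2 T` steps at its own
end `b' + 2 |P|`, with the registers of `P` and the leftover fuel `u`. [cite: AroraBarakCC2009, §1.4.1] -/
theorem iterate_meter_exit (hQ : Com.Placed Q b' (P.meter φ b' tout)) (hP : P.FreeOf φ)
    (T pc : ℕ) (R : Regs (Fin K)) (hact : ∀ m < T, (P.step^[m] ⟨pc, R⟩).pc < P.length)
    (hexit : (P.step^[T] ⟨pc, R⟩).pc = P.length) (cs u : List Bool) (hcs : cs.length = T) :
    Q.step^[2 * T] ⟨b' + 2 * pc, update R φ (cs ++ u)⟩ =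
      ⟨b' + 2 * P.length, update (P.step^[T] ⟨pc, R⟩).regs φ u⟩ := by
  rw [iterate_meter hQ hP T pc R cs u hcs hact, hexit]

end Simulation

/-! ### Exits of programs with bounded jump targets -/

/-- One step keeps the program counter at most `|P|` when all jump targets are. [folklore] -/
theorem pc_step_le {P : SProg K} (hP : P.TargetsLe P.length) {c : SCfg K} (hc : c.pc ≤ P.length) :
    (P.step c).pc ≤ P.length := by
  obtain ⟨pc, R⟩ := c
  unfold SProg.step
  cases hins : P[pc]? with
  | none => exact hc
  | some ins =>
    have hpc : pc < P.length := (List.getElem?_eq_some_iff.1 hins).1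
    have ht := hP ins (List.mem_of_getElem? hins)
    cases ins with
    | push k b => exact hpc
    | goto j => exact ht
    | pop k jt jf jn =>
      obtain ⟨h₁, h₂, h₃⟩ := ht
      simp only
      rcases hRk : R k with _ | ⟨_ | _, w⟩
      · exact h₃
      · exact h₂
      · exact h₁

/-- **Bounded jump targets confine the exit**: along any run started at an address `≤ |P|`, the
program counter stays `≤ |P|`; so the program is left only through the address `|P|`. [folklore] -/
theorem pc_iterate_le {P : SProg K} (hP : P.TargetsLe P.length) {c : SCfg K} (hc : c.pc ≤ P.length) :
    ∀ t : ℕ, (P.step^[t] c).pc ≤ P.length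
  | 0 => hc
  | t + 1 => by rw [iterate_succ_apply']; exact pc_step_le hP (pc_iterate_le hP hc t)

/-- **The first exit time.** If some iterate has left the program, there is a first time `T` at
which the program counter is `≥ |P|`; all earlier configurations are inside, and every later
iterate equals the `T`-th. [folklore] -/
theorem exists_exitTime {P : SProg K} {c : SCfg K} {t₀ : ℕ} (h : P.length ≤ (P.step^[t₀] c).pc) :
    ∃ T ≤ t₀, (∀ m < T, (P.step^[m] c).pc < P.length) ∧ P.length ≤ (P.step^[T] c).pc ∧
      ∀ t, T ≤ t → P.step^[t] c = P.step^[T] c := by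
  classical
  let T := Nat.find (⟨t₀, h⟩ : ∃ t, P.length ≤ (P.step^[t] c).pc)
  have hT : P.length ≤ (P.step^[T] c).pc := Nat.find_spec (⟨t₀, h⟩ : ∃ t, P.length ≤ (P.step^[t] c).pc)
  refine ⟨T, Nat.find_min' _ h, fun m hm => ?_, hT, fun t ht => ?_⟩
  · exact Nat.lt_of_not_le (Nat.find_min (⟨t₀, h⟩ : ∃ t, P.length ≤ (P.step^[t] c).pc) hm)
  · obtain ⟨d, rfl⟩ := Nat.exists_eq_add_of_le ht
    rw [Nat.add_comm, iterate_add_apply]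
    exact P.iterate_step_of_le hT d

/-! ### Growth of the registers -/

/-- The total number of bits held by the registers. [folklore] -/
def regsTotal (R : Regs (Fin K)) : ℕ := ∑ k, (R k).length

/-- Rewriting one register changes the total accordingly. [folklore] -/
theorem regsTotal_update (R : Regs (Fin K)) (k : Fin K) (v : List Bool) :
    regsTotal (update R k v) + (R k).length = regsTotal R + v.length := by
  unfold regsTotal
  have h₁ := Finset.sum_update_of_mem (Finset.mem_univ k) (fun i => (R i).length) v.length
  have h₂ : ∑ i, (update R k v i).length = ∑ i, update (fun i => (R i).length) k v.length i := by
    refine Finset.sum_congr rfl fun i _ => ?_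
    by_cases hi : i = k
    · subst hi; simp
    · simp [hi]
  rw [h₂, h₁, Finset.sdiff_singleton_eq_erase]
  have h₃ := Finset.add_sum_erase Finset.univ (fun i => (R i).length) (Finset.mem_univ k)
  omega

/-- **One step lengthens the registers by at most one bit in total** (a `push`; `pop` and `goto`
do not lengthen anything). [folklore] -/
theorem regsTotal_step_le (P : SProg K) (c : SCfg K) : regsTotal (P.step c).regs ≤ regsTotal c.regs + 1 := by
  obtain ⟨pc, R⟩ := c
  unfold SProg.step
  cases hins : P[pc]? with
  | none => exact Nat.le_succ _
  | some ins =>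
    cases ins with
    | push k b =>
      have := regsTotal_update R k (b :: R k)
      simp only [List.length_cons] at this
      simp only
      omega
    | goto j => exact Nat.le_succ _
    | pop k jt jf jn =>
      simp only
      rcases hRk : R k with _ | ⟨_ | _, w⟩
      · exact Nat.le_succ _
      all_goals
        have := regsTotal_update R k w
        rw [hRk, List.length_cons] at this
        simp only
        omega

/-- After `t` steps the registers hold at most `t` more bits in total. [folklore] -/
theorem regsTotal_iterate_le (P : SProg K) (c : SCfg K) :
    ∀ t : ℕ, regsTotal (P.step^[t] c).regs ≤ regsTotal c.regs + t
  | 0 => le_rfl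
  | t + 1 => by
    rw [iterate_succ_apply']
    exact (regsTotal_step_le P _).trans (by have := regsTotal_iterate_le P c t; omega)

/-- Each register is bounded by the total. [folklore] -/
theorem length_le_regsTotal (R : Regs (Fin K)) (k : Fin K) : (R k).length ≤ regsTotal R :=
  Finset.single_le_sum (f := fun i => (R i).length) (fun _ _ => Nat.zero_le _) (Finset.mem_univ k)

end SProg

/-! ### Compiled structured programs: jump targets, mentioned registers, the first exit time -/

namespace Com

variable {K : ℕ}

/-- The structured program does not mention the register `φ`. [folklore] -/
def FreeOf {ι : Type} (φ : ι) : Com ι → Prop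
  | push k _ => k ≠ φ
  | pop k ct cf cn => k ≠ φ ∧ ct.FreeOf φ ∧ cf.FreeOf φ ∧ cn.FreeOf φ
  | seq c₁ c₂ => c₁.FreeOf φ ∧ c₂.FreeOf φ
  | skip => True
  | loop k ct cf => k ≠ φ ∧ ct.FreeOf φ ∧ cf.FreeOf φ
  | halt => True

/-- A program renamed along `f` does not mention registers outside the range of `f`. [folklore] -/
theorem freeOf_map {ι κ : Type} (f : ι → κ) {φ : κ} (hφ : ∀ i, f i ≠ φ) :
    ∀ c : Com ι, (c.map f).FreeOf φ
  | push k _ => hφ k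
  | pop k ct cf cn => ⟨hφ k, freeOf_map f hφ ct, freeOf_map f hφ cf, freeOf_map f hφ cn⟩
  | seq c₁ c₂ => ⟨freeOf_map f hφ c₁, freeOf_map f hφ c₂⟩
  | skip => trivial
  | loop k ct cf => ⟨hφ k, freeOf_map f hφ ct, freeOf_map f hφ cf⟩
  | halt => trivial

/-- **The code of a program mentions only its registers.** [folklore] -/
theorem freeOf_code {φ : Fin K} : ∀ (c : Com (Fin K)), c.FreeOf φ → ∀ (base fin : ℕ),
    SProg.FreeOf φ (code c base fin)
  | push k b, h, _, _ => by
    intro ins hins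
    simp only [code, List.mem_singleton] at hins
    subst hins; exact h
  | pop k ct cf cn, ⟨hk, hct, hcf, hcn⟩, base, fin => by
    intro ins hins
    simp only [code, List.mem_cons, List.mem_append, List.mem_nil_iff, or_false] at hins
    rcases hins with (rfl | h) | rfl | h | rfl | h | rfl
    · exact hk
    · exact freeOf_code ct hct _ _ ins h
    · trivial
    · exact freeOf_code cf hcf _ _ ins h
    · trivial
    · exact freeOf_code cn hcn _ _ ins h
    · trivial
  | seq c₁ c₂, ⟨h₁, h₂⟩, base, fin => by
    intro ins hins
    simp only [code, List.mem_append] at hins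
    rcases hins with h | h
    · exact freeOf_code c₁ h₁ _ _ ins h
    · exact freeOf_code c₂ h₂ _ _ ins h
  | skip, _, _, _ => by intro ins hins; simp [code] at hins
  | loop k ct cf, ⟨hk, hct, hcf⟩, base, fin => by
    intro ins hins
    simp only [code, List.mem_cons, List.mem_append, List.mem_nil_iff, or_false] at hins
    rcases hins with (rfl | h) | rfl | h | rfl
    · exact hk
    · exact freeOf_code ct hct _ _ ins h
    · trivial
    · exact freeOf_code cf hcf _ _ ins h
    · trivial
  | halt, _, _, _ => by
    intro ins hins
    simp only [code, List.mem_singleton] at hins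
    subst hins; trivial

/-- **All jump targets of compiled code are at most `max (base + |c|) fin`** (`pop`/`loop` jump
into their own layout, `halt` jumps to `fin`). [folklore] -/
theorem targetsLe_of_mem_code : ∀ (c : Com (Fin K)) (base fin : ℕ) (ins : SInstr K),
    ins ∈ code c base fin → ins.TargetsLe (max (base + c.size) fin)
  | push k b, base, fin, ins, hins => by
    simp only [code, List.mem_singleton] at hins
    subst hins; trivial
  | pop k ct cf cn, base, fin, ins, hins => by
    simp only [code, List.mem_cons, List.mem_append, List.mem_nil_iff, or_false] at hins
    have hs : (pop k ct cf cn).size = ct.size + cf.size + cn.size + 4 := rfl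
    rcases hins with (rfl | h) | rfl | h | rfl | h | rfl
    · refine ⟨?_, ?_, ?_⟩ <;> simp only [hs] <;> omega
    · exact (targetsLe_of_mem_code ct _ _ ins h).mono (by simp only [hs]; omega)
    · show _ ≤ _; simp only [hs]; omega
    · exact (targetsLe_of_mem_code cf _ _ ins h).mono (by simp only [hs]; omega)
    · show _ ≤ _; simp only [hs]; omega
    · exact (targetsLe_of_mem_code cn _ _ ins h).mono (by simp only [hs]; omega)
    · show _ ≤ _; simp only [hs]; omega
  | seq c₁ c₂, base, fin, ins, hins => by
    simp only [code, List.mem_append] at hins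
    have hs : (seq c₁ c₂).size = c₁.size + c₂.size := rfl
    rcases hins with h | h
    · exact (targetsLe_of_mem_code c₁ _ _ ins h).mono (by simp only [hs]; omega)
    · exact (targetsLe_of_mem_code c₂ _ _ ins h).mono (by simp only [hs]; omega)
  | skip, _, _, ins, hins => by simp [code] at hins
  | loop k ct cf, base, fin, ins, hins => by
    simp only [code, List.mem_cons, List.mem_append, List.mem_nil_iff, or_false] at hins
    have hs : (loop k ct cf).size = ct.size + cf.size + 3 := rfl
    rcases hins with (rfl | h) | rfl | h | rfl
    · refine ⟨?_, ?_, ?_⟩ <;> simp only [hs] <;> omega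
    · exact (targetsLe_of_mem_code ct _ _ ins h).mono (by simp only [hs]; omega)
    · show _ ≤ _; simp only [hs]; omega
    · exact (targetsLe_of_mem_code cf _ _ ins h).mono (by simp only [hs]; omega)
    · show _ ≤ _; simp only [hs]; omega
  | halt, base, fin, ins, hins => by
    simp only [code, List.mem_singleton] at hins
    subst hins
    exact le_max_right _ _

/-- The whole-program compilation jumps at most to its own end. [folklore] -/
theorem compile_targetsLe (c : Com (Fin K)) : SProg.TargetsLe (compile c).length (compile c) := by
  intro ins hins
  have h := targetsLe_of_mem_code c 0 c.size ins hins
  rw [Nat.zero_add, max_self] at h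
  rwa [length_compile]

/-- The whole-program compilation mentions only the registers of the program. [folklore] -/
theorem compile_freeOf {φ : Fin K} {c : Com (Fin K)} (h : c.FreeOf φ) : SProg.FreeOf φ (compile c) :=
  freeOf_code c h 0 c.size

/-- **The first exit time of a normal execution.** If `Exec c R false R' t`, the compiled program
started at `⟨0, R⟩` has a first exit time `T ≤ t`: the first `T` configurations are inside the
code, and the `T`-th (and every later) iterate is `⟨|c|, R'⟩`. With `SProg.iterate_meter_exit` /
`SProg.iterate_meter_timeout` this is what decides a metered run of `compile c` by its fuel:
at least `T + 1` fuel symbols complete it with registers `R'` and fuel left over, at most `T`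
time it out. [cite: AroraBarakCC2009, §1.4.1] -/
theorem Exec.exists_exitTime {c : Com (Fin K)} {R R' : Regs (Fin K)} {t : ℕ}
    (h : Exec c R false R' t) :
    ∃ T ≤ t, (∀ m < T, ((compile c).step^[m] ⟨0, R⟩).pc < (compile c).length) ∧
      ∀ t', T ≤ t' → (compile c).step^[t'] ⟨0, R⟩ = ⟨c.size, R'⟩ := by
  have ht : (compile c).step^[t] ⟨0, R⟩ = ⟨c.size, R'⟩ := h.compile_iterate le_rfl
  have hle : (compile c).length ≤ ((compile c).step^[t] ⟨0, R⟩).pc := by rw [ht, length_compile]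
  obtain ⟨T, hTt, hact, -, hfix⟩ := SProg.exists_exitTime hle
  refine ⟨T, hTt, hact, fun t' ht' => ?_⟩
  rw [hfix t' ht', ← hfix t hTt, ht]

end Com

end Literature.Computability.Complexity
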